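import Summits.Ventures.PercRepro.S2FiveWindow
import Summits.Ventures.PercRepro.S1RowEightAll

/-!
# PercRepro — S2: THE ROW STEP OF THE LEVEL-5 LADDER (p7, gen 20; sub-claim S2)

Theorem C₅ at `P` (`RLS M p 5` for every finite matroid and every `p ≥ P`) follows from Theorem C₅ at `P + 1`, the `p = P − 1` and
`p = P` rows of the `e`-free core (every corank `d ≥ 6`) and level `4` at every `p ≥ 6` (`S1.c025_four_all`), through the kit's
reduction `S2.rls_five_of_four_of_core (P − 1)`: **`c025_five_large_of_rows (P) (hP : 7 ≤ P) (hrow1) (hrow2) (hnext) (M) (p) (hp : P ≤ p) :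
RLS M p 5`**. Every rung of the ladder `15 → 14 → … → 8` is this theorem applied to its two rows. Axioms: standard.
-/

open scoped Matroid

namespace PercRepro

namespace ThmN

variable {α : Type}

/-- **THE ROW STEP**: Theorem C₅ at `P` from the rows `P − 1` and `P` of the `e`-free core and Theorem C₅ at `P + 1`. -/
theorem c025_five_large_of_rows (P : ℕ) (hP : 7 ≤ P)
    (hrow1 : ∀ (M : Matroid α) [M.Finite], M.eRank = ((P - 1 : ℕ) : ℕ∞) → P - 1 + 5 < M.E.ncard →
      (∀ e ∈ M.E, ∃ A ⊆ M.E \ {e}, e ∉ M.closure A ∧ e ∉ M.closure ((M.E \ {e}) \ A)) → RLS M (P - 1) 5)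
    (hrow2 : ∀ (M : Matroid α) [M.Finite], M.eRank = ((P : ℕ) : ℕ∞) → P + 5 < M.E.ncard →
      (∀ e ∈ M.E, ∃ A ⊆ M.E \ {e}, e ∉ M.closure A ∧ e ∉ M.closure ((M.E \ {e}) \ A)) → RLS M P 5)
    (hnext : ∀ (M : Matroid α) [M.Finite] (p : ℕ), P + 1 ≤ p → RLS M p 5)
    (M : Matroid α) [M.Finite] (p : ℕ) (hp : P ≤ p) : RLS M p 5 := by
  refine S2.rls_five_of_four_of_core (P - 1) (by omega) (fun M _ p hp => S1.c025_four_all M p (by omega)) ?_ M p (by omega)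
  intro M _ p hP' hR hbig hfree
  rcases Nat.lt_or_ge p P with h | h
  · have hp' : p = P - 1 := by omega
    subst hp'
    exact hrow1 M hR hbig hfree
  rcases Nat.lt_or_ge p (P + 1) with h' | h'
  · have hp' : p = P := by omega
    subst hp'
    exact hrow2 M hR hbig hfree
  · exact hnext M p h'

end ThmN

end PercRepro
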